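import Literature.AlgebraicGeometry.Frobenioids.ArchimedeanPerfectionRadialTransport
import Literature.AlgebraicGeometry.Frobenioids.ArchimedeanPerfectionRationalFunctionMonoid
import Literature.AlgebraicGeometry.Frobenioids.BiratUnitsIntertwinesRoots
import Literature.AlgebraicGeometry.Frobenioids.PerfectionGroupificationEquiv
import Literature.AlgebraicGeometry.Frobenioids.PerfectionDivisorial
import Literature.AlgebraicGeometry.Frobenioids.PerfectionPrimes
import Literature.AlgebraicGeometry.Frobenioids.MonoidFunctors
import HarnessLib

/-!
# Frobenioids II, Thm. 3.6 (i) at `Λ = ℚ`, FILE A-4 part (S): the radial SECTION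
# `σ_X : (Φ^pf)^gp(Base A) → O^×((A, n)^birat)` of the divisor map of `C^ℚ = C^pf`, and its naturality `(T-rad)`

Mochizuki, *The geometry of Frobenioids II: poly-Frobenioids*, Kyushu J. Math. **62** (2008) 401–460, §3,
Thm. 3.6 (i) p. 36 ("rational function monoid naturally isomorphic to `(Φ^fld)^Λ`")
[cite: MochizukiFrdII2008, Thm 3.6 (i) p.36]; [FrdI] Prop. 4.4 (iii)/(iv) p. 83 (the surjection
`O^×(A^birat) ↠ Φ^birat`; naturality of `O^×(−)`) [cite: MochizukiFrdI2008, Prop. 4.4 (iii) p.83].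

abc-iut cell, layer L1, row M13-c3, **FILE A-4 (S) + hrad** (seat abc-iut-w5-d246, per L1-lead R122 (1)/R127 (2)):
for every `X = (A, n)` of THE perfection `C^pf` of the archimedean Frobenioid, at the Frobenioid-structure witness
`pf_isFrobenioid π hF` of abc-iut-L1-t6:
* `radialSectionGp π hF X : PhiGp (pfStr π hF) X →* BiratUnits (pfStr π hF) (pf_isFrobenioid π hF) X` — the group
  homomorphism extending the radial section `σ₀ = radialSection` (file `ArchimedeanPerfectionRadialSection`, at a
  naively isotropic level; canonical by `radialSection_mul_eq`) through `Φ = ℝ_{≥0}` PERFECT (`Φ ≅ Φ^pf`) and the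
  universal property of `(−)^gp` (`O^×(X^birat)` is commutative: abc-iut-L1-t6's `biratUnits_mul_comm`);
* `divHom_radialSectionGp` — it is a SECTION of the divisor map: `divHom (σ_X x) = x` (the `hσ` of L1-t6's
  `istrModel_Q_of_section`);
* `intertwines_radialSectionGp` — `(T-rad)` in the binder shape `hrad` of L1-t6's `istrModel_Q_of_section`
  (from file `ArchimedeanPerfectionRadialTransport`'s `intertwines_radialSection`, by the closure algebra of
  abc-iut-w5-d194's `Intertwines.div`).
Defs `isoLevel`, `radialSectionPerf`, `radialSectionGp`; nothing here bears on [IUTchIII] Cor. 3.12.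
-/

noncomputable section

namespace Literature.AlgebraicGeometry.Frobenioids

open CategoryTheory Opposite
open scoped NNReal

universe v u

namespace ArchFrd

namespace Thm36Sub

variable {D : Type u} [Category.{v} D] (π : D ⥤ D0) (hF : PreFrobenioid.IsFrobenioid (C.toElem π))

open PreFrobenioid PreFrobenioid.Perfection

/-- A naively isotropic Frobenius level of `A` (choice; Lemma 3.2 (v)). [cite: MochizukiFrdII2008, Lem 3.2 (v) p.25] -/
def isoLevel (X : pfCat π hF) : ℕ+ := (exists_isotropic_levels X).choose

/-- `A^{(isoLevel)}` is naively isotropic. [cite: MochizukiFrdII2008, Lem 3.2 (v) p.25] -/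
theorem isoLevel_spec (X : pfCat π hF) : (frobPow hF X.obj (isoLevel π hF X)).fst.IsNaivelyIsotropic :=
  (exists_isotropic_levels X).choose_spec _ (dvd_refl _)

/-- `Φ(Base A) = ℝ_{≥0}` is perfect, hence is its own perfection: `Φ ≃* Φ^pf`. [cite: MochizukiFrdI2008, §0 p.11] -/
def phiEquivPerfection (X : pfCat π hF) :
    ((Φ π).obj (op X.obj.snd)) ≃* Frobenioids.Perfection ((Φ π).obj (op X.obj.snd)) :=
  (show IsPerfect ((Φ π).obj (op X.obj.snd)) from isPerfect_multiplicative_nnreal).equivPerfection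

/-- The radial section read on `Φ^pf(Base A)` (through `Φ ≃ Φ^pf`), at the canonical isotropic level.
[cite: MochizukiFrdII2008, Thm 3.6 (i) p.36] -/
def radialSectionPerf (X : pfCat π hF) :
    Frobenioids.Perfection ((Φ π).obj (op X.obj.snd)) →* BiratUnits (pfStr π hF) (pf_isFrobenioid π hF) X :=
  (radialSection X (pf_isFrobenioid π hF) (isoLevel_spec π hF X)).comp (phiEquivPerfection π hF X).symm.toMonoidHom

/-- `radialSectionPerf (of a) = radialSection a`. [cite: MochizukiFrdII2008, Thm 3.6 (i) p.36] -/
theorem radialSectionPerf_of (X : pfCat π hF) (a : (Φ π).obj (op X.obj.snd)) :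
    radialSectionPerf π hF X (Frobenioids.Perfection.of _ a) =
      radialSection X (pf_isFrobenioid π hF) (isoLevel_spec π hF X) a := by
  change radialSection X _ _ ((phiEquivPerfection π hF X).symm (Frobenioids.Perfection.of _ a)) = _
  rw [show Frobenioids.Perfection.of _ a = phiEquivPerfection π hF X a from rfl, MulEquiv.symm_apply_apply]

/-- **(S) The radial section `σ_X : (Φ^pf)^gp(Base A) →* O^×((A, n)^birat)`** of the divisor map of `C^pf` — the
`Φ^gp`-half of "rational function monoid `≅ (Φ^gp × Φ^∡)^pf`". [cite: MochizukiFrdII2008, Thm 3.6 (i) p.36] -/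
def radialSectionGp (X : pfCat π hF) :
    Algebra.GrothendieckGroup (Frobenioids.Perfection ((Φ π).obj (op X.obj.snd))) →*
      BiratUnits (pfStr π hF) (pf_isFrobenioid π hF) X :=
  letI := commGroupOfComm (biratUnits_mul_comm (π := π) (hF := hF) X)
  Algebra.GrothendieckGroup.lift (radialSectionPerf π hF X)

/-- `σ_X (of p) = radialSectionPerf p`. [cite: MochizukiFrdII2008, Thm 3.6 (i) p.36] -/
theorem radialSectionGp_of (X : pfCat π hF) (p : Frobenioids.Perfection ((Φ π).obj (op X.obj.snd))) :
    radialSectionGp π hF X (Algebra.GrothendieckGroup.of p) = radialSectionPerf π hF X p := by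
  letI := commGroupOfComm (biratUnits_mul_comm (π := π) (hF := hF) X)
  exact gp_lift_of _ p

/-- `σ_X (of (of a)) = radialSection a`. [cite: MochizukiFrdII2008, Thm 3.6 (i) p.36] -/
theorem radialSectionGp_of_of (X : pfCat π hF) (a : (Φ π).obj (op X.obj.snd)) :
    radialSectionGp π hF X (Algebra.GrothendieckGroup.of (Frobenioids.Perfection.of _ a)) =
      radialSection X (pf_isFrobenioid π hF) (isoLevel_spec π hF X) a :=
  (radialSectionGp_of π hF X _).trans (radialSectionPerf_of π hF X a)

/-- **`hσ`: `σ_X` is a section of the divisor map**: `divHom (σ_X x) = x` for all `x ∈ (Φ^pf)^gp(Base A)`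
([FrdI] Prop. 4.4 (iii): `O^×(A^birat) ↠ Φ^birat = Φ^gp`). [cite: MochizukiFrdI2008, Prop. 4.4 (iii) p.83] -/
theorem divHom_radialSectionGp (X : pfCat π hF) (x : PhiGp (pfStr π hF) X) :
    BiratUnits.divHom (pf_isFrobenioid π hF) X (radialSectionGp π hF X x) = x := by
  suffices h : (BiratUnits.divHom (pf_isFrobenioid π hF) X).comp (radialSectionGp π hF X) = MonoidHom.id _ from
    DFunLike.congr_fun h x
  apply gp_hom_ext
  refine MonoidHom.ext fun p => ?_
  change BiratUnits.divHom (pf_isFrobenioid π hF) X (radialSectionGp π hF X (Algebra.GrothendieckGroup.of p)) =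
    Algebra.GrothendieckGroup.of p
  obtain ⟨a, rfl⟩ := (phiEquivPerfection π hF X).surjective p
  change BiratUnits.divHom _ X (radialSectionGp π hF X (Algebra.GrothendieckGroup.of (Frobenioids.Perfection.of _ a))) =
    Algebra.GrothendieckGroup.of (Frobenioids.Perfection.of _ a)
  rw [radialSectionGp_of_of, divHom_radialSection]

/-- Every element of `Φ^gp` is a quotient `of m / of s`. [cite: MochizukiFrdI2008, §0 p.11] -/
theorem gp_mk_eq_div {M : Type*} [CommMonoid M] (m : M) (s : (⊤ : Submonoid M)) :
    (Localization.mk m s : Algebra.GrothendieckGroup M) =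
      Algebra.GrothendieckGroup.of m / Algebra.GrothendieckGroup.of (s : M) := by
  rw [Localization.mk_eq_monoidOf_mk'_apply, Submonoid.LocalizationMap.mk'_eq_iff_eq_mul]
  exact (div_mul_cancel (Algebra.GrothendieckGroup.of m) (Algebra.GrothendieckGroup.of (s : M))).symm

/-- The pull-back `Φ(Base ψ)` of the constant divisor monoid is the identity. [cite: MochizukiFrdII2008, Ex 3.3 (i) p.27] -/
theorem phi_map_hom_apply {d d' : D} (f : d ⟶ d') (z : (Φ π).obj (op d')) : ((Φ π).map f.op).hom z = z := rfl

/-- `(T-rad)` for `σ`, with the pull-back homomorphism abstracted (any `g` acting as the identity on the constant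
divisor monoid). [cite: MochizukiFrdII2008, Thm 3.6 (i) p.36] -/
theorem intertwines_radialSectionGp_aux ⦃X X' : pfCat π hF⦄ (ψ : X ⟶ X') (hψ : IsLinear (pfStr π hF) ψ)
    (g : (Φ π).obj (op X'.obj.snd) →* (Φ π).obj (op X.obj.snd)) (hg : ∀ a, g a = a)
    (z : Algebra.GrothendieckGroup ((Φ π).obj (op X'.obj.snd))) :
    BiratUnits.Intertwines (pf_isFrobenioid π hF) ψ
      (radialSectionGp π hF X (gpMap (Frobenioids.Perfection.of ((Φ π).obj (op X.obj.snd))) (gpMap g z)))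
      (radialSectionGp π hF X' (gpMap (Frobenioids.Perfection.of ((Φ π).obj (op X'.obj.snd))) z)) := by
  have hsq := PreFrobenioid.hasBiratSquares_of_isFrobenioid (pf_isFrobenioid π hF)
  induction z using Localization.induction_on with
  | H y =>
    obtain ⟨m, s⟩ := y
    have h1 := intertwines_radialSection (pf_isFrobenioid π hF) ψ hψ (isoLevel_spec π hF X) (isoLevel_spec π hF X') m
    have h2 := intertwines_radialSection (pf_isFrobenioid π hF) ψ hψ (isoLevel_spec π hF X) (isoLevel_spec π hF X')
      (s : (Φ π).obj (op X'.obj.snd))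
    have e1 : radialSectionGp π hF X (gpMap (Frobenioids.Perfection.of ((Φ π).obj (op X.obj.snd)))
        (gpMap g (Localization.mk m s))) =
        radialSection X (pf_isFrobenioid π hF) (isoLevel_spec π hF X) m /
          radialSection X (pf_isFrobenioid π hF) (isoLevel_spec π hF X) (s : (Φ π).obj (op X'.obj.snd)) := by
      rw [gp_mk_eq_div]
      simp only [map_div, gpMap_of, hg, radialSectionGp_of_of]
    have e2 : radialSectionGp π hF X' (gpMap (Frobenioids.Perfection.of ((Φ π).obj (op X'.obj.snd)))
        (Localization.mk m s)) =
        radialSection X' (pf_isFrobenioid π hF) (isoLevel_spec π hF X') m /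
          radialSection X' (pf_isFrobenioid π hF) (isoLevel_spec π hF X') (s : (Φ π).obj (op X'.obj.snd)) := by
      rw [gp_mk_eq_div]
      simp only [map_div, gpMap_of, radialSectionGp_of_of]
    rw [e1, e2]
    exact h1.div hsq h2

/-- **`hrad` — (T-rad) for the section `σ`**: along every LINEAR `ψ : X → X′` of `C^pf`,
`σ_X ((Φ^pf)^gp(Base ψ) z)` and `σ_{X′}(z)` are intertwined, for all `z ∈ Φ^gp(Base A′)` (the binder `hrad` of
abc-iut-L1-t6's `istrModel_Q_of_section`, verbatim). [cite: MochizukiFrdII2008, Thm 3.6 (i) p.36] -/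
theorem intertwines_radialSectionGp ⦃X X' : pfCat π hF⦄ (ψ : X ⟶ X') (hψ : IsLinear (pfStr π hF) ψ)
    (z : Algebra.GrothendieckGroup ((Φ π).obj (op X'.obj.snd))) :
    BiratUnits.Intertwines (pf_isFrobenioid π hF) ψ
      (radialSectionGp π hF X (gpMap (Frobenioids.Perfection.of ((Φ π).obj (op X.obj.snd)))
        (gpMap ((Φ π).map (Base (pfStr π hF) ψ).op).hom z)))
      (radialSectionGp π hF X' (gpMap (Frobenioids.Perfection.of ((Φ π).obj (op X'.obj.snd))) z)) :=
  intertwines_radialSectionGp_aux π hF ψ hψ ((Φ π).map (Base (pfStr π hF) ψ).op).hom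
    (phi_map_hom_apply π (Base (pfStr π hF) ψ)) z

end Thm36Sub

end ArchFrd

end Literature.AlgebraicGeometry.Frobenioids

end
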